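import Literature.Probability.LatticeModels.ThermodynamicLimit
import Mathlib.Combinatorics.SimpleGraph.Walk.Counting
import HarnessLib

/-!
# Simple random walk on `ℤ^d` coded by step sequences

The `n`-step nearest-neighbour walks of `ℤ^d` from the origin, coded by their sequences of steps
`ω : Fin n → Dir d` (`Dir d = Fin d × Bool`, the `2d` unit vectors `±eᵢ`); the uniform counting of
such sequences is the simple random walk (SRW). The four-dimensional weakly self-avoiding walk
(`Literature/Barriers/CriticalPhenomena/WeaklySAWFourDimLogCorrections.lean`) needs `d = 4`; this
file is the general-`d` home of the coding at the `LatticeModels` layer.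

## Prior codings of the same object in the tree (to be retargeted here)

This is NOT the first step-word coding of `ℤ^d` in the tree; it is the one placed low enough in the
import graph (`Probability/LatticeModels`) to serve all users, and the duplicates below are to be
retargeted to it by a librarian `refactor:` follow-up:

* `Literature.Probability.Percolation.stepVec` (`Percolation/DualContours.lean`) is definitionally
  equal to `SRW.stepVec` (same `if a.2 then Pi.single a.1 1 else -Pi.single a.1 1`; `rfl`);
  `Literature.Probability.Percolation.zdGraph_adj_iff_stepVec` (ibid.) is
  `exists_dir_of_adj` + `adj_add_stepVec` here;
* `Literature.Probability.Percolation.srev` (`Percolation/SusceptibilityPathCounting.lean`) is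
  `SRW.Dir.neg` by `rfl` (`srev_srev` / `stepVec_srev` = `Dir.neg_neg` / `stepVec_neg`);
* `Literature.Probability.Percolation.wordPos` (`DualContours.lean`, with `wordPos_zero`,
  `wordPos_succ`) agrees with `SRW.pos` for `k ≤ n` — this is exactly `pos_eq_sum_range` below
  (`pos` is frozen at the endpoint for `k ≥ n`, `wordPos` keeps the same value there too);
* the planar coding `Literature.Barriers.CriticalPhenomena.Edwards2D.StepSeq`
  (`Barriers/CriticalPhenomena/PlanarEdwardsModelDiffusive.lean`, `d = 2` with `Fin 4`, not
  reducibly the same type) and its bridge `sum_walks_eq_sum_stepSeq`, which the bridge below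
  generalises to all `d`.

(`Percolation` imports `LatticeModels`, so the identification cannot be stated in this file.)

## Contents (namespace `Literature.Probability.LatticeModels.SRW`)

* `Dir d`, `stepVec`, `Dir.neg` (the `2d` steps, `stepVec (i, tt) = eᵢ`, `stepVec (i, ff) = -eᵢ`);
* `StepSeq d n = Fin n → Dir d`, positions `pos ω k = ω(k) = Σ_{i<k} e_{ωᵢ}`, `endpoint ω = ω(n)`;
* the **bridge** to the walks of `zdGraph d` (`toWalk`, `ofWalk`, `getVert_toWalk`,
  `sum_walks_eq_sum_stepSeq`): summing over `x ∈ box d n`, `p ∈ (zdGraph d).finsetWalkLength n 0 x`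
  — the indexing used by `Literature.Probability.RandomPlanarGeometry.SAW.Zd.weaklyCountAt` and by
  the jump-chain representation of the continuous-time weakly self-avoiding walk — is summing over
  `StepSeq d n`;
* `count d n x = #{ω : StepSeq d n | ω(n) = x}`, the number of `n`-step walks `0 → x` (so that
  `P(S_n = x) = count d n x / (2d)^n` for the SRW `S`); by `card_finsetWalkLength_eq_count` it is
  `#((zdGraph d).finsetWalkLength n 0 x)`, i.e. the real number
  `Literature.Probability.RandomPlanarGeometry.SAW.Zd.weaklyCountAt d 0 n x` (all weights `1` at
  `λ = 0`; that glue belongs to a file importing `BDGS2012.lean`). NAMING: in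
  `RandomPlanarGeometry/BDGS2012.lean` the per-endpoint SELF-AVOIDING count is `SAW.Zd.countAt`
  (walks filtered by `IsPath`) and `SAW.Zd.count` is its total; here `SRW.count d n x` is the
  per-endpoint count of ALL walks and the total is `(2d)^n` (`sum_box_count`) — different
  namespace, different object, no clash;
  its support (`count_eq_zero_of_not_mem_box`), total mass (`sum_box_count`), `count_zero`,
  negation symmetry `count_neg`.

Convolution identities, the maximum principle and the Fourier bound for `count` are in the
companion files `SRWReturnCounts.lean` / `SRWReturnFourier.lean` (forthcoming in the same series).
Everything here is folklore (Spitzer 1976, §1; Lawler–Limic 2010, §1.1) and fully proved.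
-/

noncomputable section

open Finset SimpleGraph

namespace Literature.Probability.LatticeModels

namespace SRW

variable {d : ℕ}

/-! ### Directions and unit steps -/

/-- The `2d` directions of `ℤ^d`: a coordinate and a sign. [folklore] -/
abbrev Dir (d : ℕ) : Type := Fin d × Bool

/-- The unit step of a direction: `(i, true) ↦ eᵢ`, `(i, false) ↦ -eᵢ` (definitionally the
`Literature.Probability.Percolation.stepVec` of `Percolation/DualContours.lean`, which is to be
retargeted here). [folklore] -/
def stepVec (v : Dir d) : Site d := if v.2 then Pi.single v.1 1 else -Pi.single v.1 1

/-- There are `2d` directions. [folklore] -/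
theorem card_dir (d : ℕ) : Fintype.card (Dir d) = 2 * d := by
  simp [Fintype.card_prod, mul_comm]

/-- The opposite direction (`rfl`-equal to `Literature.Probability.Percolation.srev` of
`Percolation/SusceptibilityPathCounting.lean`, to be retargeted here). [folklore] -/
def Dir.neg (v : Dir d) : Dir d := (v.1, !v.2)

/-- `neg` is an involution. [folklore] -/
@[simp] theorem Dir.neg_neg (v : Dir d) : v.neg.neg = v := by
  simp [Dir.neg]

/-- `neg` is a bijection. [folklore] -/
theorem Dir.neg_bijective : Function.Bijective (Dir.neg : Dir d → Dir d) :=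
  Function.Involutive.bijective Dir.neg_neg

/-- The step of the opposite direction is the opposite step. [folklore] -/
@[simp] theorem stepVec_neg (v : Dir d) : stepVec v.neg = -stepVec v := by
  unfold stepVec Dir.neg
  cases v.2 <;> simp

/-- Coordinates of a unit step. [folklore] -/
theorem stepVec_apply (v : Dir d) (j : Fin d) :
    stepVec v j = if j = v.1 then (if v.2 then 1 else -1) else 0 := by
  unfold stepVec
  by_cases hj : j = v.1
  · subst hj; cases v.2 <;> simp
  · cases v.2 <;> simp [hj]

/-- Each coordinate of a unit step is at most one in absolute value. [folklore] -/
theorem abs_stepVec_apply_le (v : Dir d) (j : Fin d) : |stepVec v j| ≤ 1 := by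
  rw [stepVec_apply]
  split_ifs <;> simp

/-- The coordinate sum of a unit step is `±1` according to its sign. [folklore] -/
theorem sum_stepVec_apply (v : Dir d) : ∑ j, stepVec v j = if v.2 then 1 else -1 := by
  simp_rw [stepVec_apply]
  rw [Finset.sum_ite_eq' Finset.univ v.1]
  simp

/-- `stepVec` is injective: a unit step determines its direction. [folklore] -/
theorem stepVec_injective : Function.Injective (stepVec : Dir d → Site d) := by
  intro v w h
  have h1 := congrFun h v.1
  rw [stepVec_apply, stepVec_apply, if_pos rfl] at h1
  have hi : v.1 = w.1 := by
    by_contra hne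
    rw [if_neg hne] at h1
    revert h1
    cases v.2 <;> simp
  refine Prod.ext hi ?_
  rw [if_pos hi] at h1
  revert h1
  cases v.2 <;> cases w.2 <;> simp

/-- `x` and `x + e` are nearest neighbours in `zdGraph d` for every unit step `e`. [folklore] -/
theorem adj_add_stepVec (x : Site d) (v : Dir d) : (zdGraph d).Adj x (x + stepVec v) := by
  rw [zdGraph_adj_iff]
  refine ⟨v.1, ?_⟩
  unfold stepVec
  cases v.2
  · right; simp
  · left; simp

/-- Conversely, nearest neighbours differ by a unit step. [folklore] -/
theorem exists_dir_of_adj {x y : Site d} (h : (zdGraph d).Adj x y) : ∃ v : Dir d, y = x + stepVec v := by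
  rw [zdGraph_adj_iff] at h
  obtain ⟨i, h | h⟩ := h
  · exact ⟨(i, true), by simp [stepVec, h]⟩
  · exact ⟨(i, false), by rw [h]; simp [stepVec]⟩

/-- The direction from `x` to an adjacent `y` (by choice; unique by `stepVec_injective`).
[folklore] -/
def dirOf {x y : Site d} (h : (zdGraph d).Adj x y) : Dir d := (exists_dir_of_adj h).choose

/-- `x + e_{dirOf} = y`. [folklore] -/
theorem add_stepVec_dirOf {x y : Site d} (h : (zdGraph d).Adj x y) : x + stepVec (dirOf h) = y :=
  (exists_dir_of_adj h).choose_spec.symm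

/-- `dirOf` recovers the direction of a unit step. [folklore] -/
theorem dirOf_adj_add_stepVec (x : Site d) (v : Dir d) (h : (zdGraph d).Adj x (x + stepVec v)) :
    dirOf h = v :=
  stepVec_injective (add_left_cancel (add_stepVec_dirOf h))

/-! ### Step sequences, positions, endpoint -/

/-- An `n`-step nearest-neighbour walk from the origin of `ℤ^d`, coded by its steps; the uniform
counting measure on `StepSeq d n` (`(2d)^n` elements) is the simple random walk.
[folklore] -/
abbrev StepSeq (d n : ℕ) : Type := Fin n → Dir d

variable {n : ℕ}

/-- There are `(2d)^n` step sequences. [folklore] -/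
theorem card_stepSeq (d n : ℕ) : Fintype.card (StepSeq d n) = (2 * d) ^ n := by
  rw [Fintype.card_fun, Fintype.card_fin, card_dir]

/-- Position after `k` steps, `ω(k) = Σ_{i<k} e_{ωᵢ}` (constant `= ω(n)` for `k ≥ n`); agrees with
`Literature.Probability.Percolation.wordPos` of `Percolation/DualContours.lean` (`pos_eq_sum_range`),
which is to be retargeted here. [folklore] -/
def pos (ω : StepSeq d n) (k : ℕ) : Site d :=
  ∑ i : Fin n, if (i : ℕ) < k then stepVec (ω i) else 0

/-- The endpoint `ω(n)`. [folklore] -/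
def endpoint (ω : StepSeq d n) : Site d := ∑ i : Fin n, stepVec (ω i)

/-- `ω(0) = 0`. [folklore] -/
@[simp] theorem pos_zero (ω : StepSeq d n) : pos ω 0 = 0 := by simp [pos]

/-- `ω(k) = ω(n)` for `k ≥ n`. [folklore] -/
theorem pos_of_le (ω : StepSeq d n) {k : ℕ} (hk : n ≤ k) : pos ω k = endpoint ω := by
  unfold pos endpoint
  exact Finset.sum_congr rfl fun i _ => by simp [lt_of_lt_of_le i.isLt hk]

/-- `ω(n)` is the endpoint. [folklore] -/
theorem pos_eq_endpoint (ω : StepSeq d n) : pos ω n = endpoint ω := pos_of_le ω le_rfl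

/-- One more step: `ω(k+1) = ω(k) + e_{ω_k}` for `k < n`. [folklore] -/
theorem pos_succ (ω : StepSeq d n) {k : ℕ} (hk : k < n) :
    pos ω (k + 1) = pos ω k + stepVec (ω ⟨k, hk⟩) := by
  unfold pos
  rw [← sub_eq_iff_eq_add', ← Finset.sum_sub_distrib]
  rw [Finset.sum_eq_single ⟨k, hk⟩]
  · simp
  · intro i _ hi
    have hik : (i : ℕ) ≠ k := fun h => hi (Fin.ext h)
    by_cases h1 : (i : ℕ) < k
    · have h2 : (i : ℕ) < k + 1 := by omega
      simp [h1, h2]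
    · have h2 : ¬ (i : ℕ) < k + 1 := by omega
      simp [h1, h2]
  · simp

/-- `ω(k) = Σ_{i ∈ range k} e_{ωᵢ}` for `k ≤ n`, as a sum over an initial segment. [folklore] -/
theorem pos_eq_sum_range (ω : StepSeq d n) {k : ℕ} (hk : k ≤ n) :
    pos ω k = ∑ i ∈ Finset.range k, if h : i < n then stepVec (ω ⟨i, h⟩) else 0 := by
  induction k with
  | zero => simp
  | succ k ih =>
      have hk' : k < n := hk
      rw [pos_succ ω hk', ih hk'.le, Finset.sum_range_succ, dif_pos hk']

/-- Consecutive positions are nearest neighbours. [folklore] -/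
theorem pos_adj_pos_succ (ω : StepSeq d n) {k : ℕ} (hk : k < n) :
    (zdGraph d).Adj (pos ω k) (pos ω (k + 1)) := by
  rw [pos_succ ω hk]
  exact adj_add_stepVec _ _

/-- First-step decomposition of the endpoint: `(a·ω)(n+1) = e_a + ω(n)`. [folklore] -/
theorem endpoint_cons (a : Dir d) (ω : StepSeq d n) :
    endpoint (Fin.cons a ω : StepSeq d (n + 1)) = stepVec a + endpoint ω := by
  simp [endpoint, Fin.sum_univ_succ]

/-- Last-step decomposition of the endpoint: `(ω·a)(n+1) = ω(n) + e_a`. [folklore] -/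
theorem endpoint_snoc (ω : StepSeq d n) (a : Dir d) :
    endpoint (Fin.snoc ω a : StepSeq d (n + 1)) = endpoint ω + stepVec a := by
  simp [endpoint, Fin.sum_univ_castSucc]

/-- The endpoint of the empty walk is the origin. [folklore] -/
@[simp] theorem endpoint_zero (ω : StepSeq d 0) : endpoint ω = 0 := by simp [endpoint]

/-- Negating every step negates the endpoint. [folklore] -/
theorem endpoint_neg (ω : StepSeq d n) : endpoint (fun i => (ω i).neg) = -endpoint ω := by
  simp [endpoint, Finset.sum_neg_distrib]

/-- The position after `k ≤ n` steps lies in the box `{-k,…,k}^d`. [folklore] -/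
theorem pos_mem_box (ω : StepSeq d n) (k : ℕ) : pos ω k ∈ box d k := by
  rw [mem_box]
  intro j
  have h : |pos ω k j| ≤ k := by
    unfold pos
    rw [Finset.sum_apply]
    refine (Finset.abs_sum_le_sum_abs _ _).trans ?_
    calc ∑ i : Fin n, |(if (i : ℕ) < k then stepVec (ω i) else 0) j|
        ≤ ∑ i : Fin n, (if (i : ℕ) < k then (1 : ℤ) else 0) :=
          Finset.sum_le_sum fun i _ => by
            split_ifs
            · exact abs_stepVec_apply_le _ _
            · simp
      _ = ((Finset.univ.filter fun i : Fin n => (i : ℕ) < k).card : ℤ) := by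
          rw [Finset.sum_ite, Finset.sum_const_zero, add_zero, Finset.sum_const, nsmul_one]
      _ ≤ k := by
          have : (Finset.univ.filter fun i : Fin n => (i : ℕ) < k).card ≤ k := by
            calc (Finset.univ.filter fun i : Fin n => (i : ℕ) < k).card
                ≤ (Finset.range k).card := by
                  refine Finset.card_le_card_of_injOn (fun i : Fin n => (i : ℕ)) ?_ ?_
                  · intro i hi
                    simp only [Finset.coe_filter, Finset.mem_univ, true_and, Set.mem_setOf_eq] at hi
                    simpa using hi
                  · intro i _ i' _ h
                    exact Fin.ext h
              _ = k := Finset.card_range k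
          exact_mod_cast this
  exact abs_le.1 h

/-- The endpoint of an `n`-step walk lies in the box `{-n,…,n}^d`. [folklore] -/
theorem endpoint_mem_box (ω : StepSeq d n) : endpoint ω ∈ box d n := by
  rw [← pos_eq_endpoint]
  exact pos_mem_box ω n

/-! ### Bridge: step sequences ≃ `n`-step walks of `zdGraph d` from `0` -/

/-- The walk of `zdGraph d` traced by the first `k` steps (by `concat`). [folklore] -/
def walkUpTo (ω : StepSeq d n) : (k : ℕ) → (zdGraph d).Walk (0 : Site d) (pos ω k)
  | 0 => (Walk.nil : (zdGraph d).Walk (0 : Site d) 0).copy rfl (pos_zero ω).symm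
  | k + 1 =>
    if h : k < n then (walkUpTo ω k).concat (pos_adj_pos_succ ω h)
    else (walkUpTo ω k).copy rfl (by
      rw [pos_of_le ω (not_lt.1 h), pos_of_le ω ((not_lt.1 h).trans k.le_succ)])

/-- The first `k` steps visit `ω(0), …, ω(k)`. [folklore] -/
theorem support_walkUpTo (ω : StepSeq d n) :
    ∀ k, k ≤ n → (walkUpTo ω k).support = (List.range (k + 1)).map (pos ω)
  | 0, _ => by simp [walkUpTo, pos_zero]
  | k + 1, hk => by
      have h : k < n := hk
      rw [walkUpTo, dif_pos h, Walk.support_concat, support_walkUpTo ω k h.le]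
      conv_rhs => rw [List.range_succ, List.map_append, List.map_singleton]

/-- **Bridge**: the `n`-step walk of `zdGraph d` from `0` traced by a step sequence.
[folklore] -/
def toWalk (ω : StepSeq d n) : (zdGraph d).Walk (0 : Site d) (endpoint ω) :=
  (walkUpTo ω n).copy rfl (pos_eq_endpoint ω)

/-- `toWalk ω` visits `ω(0), …, ω(n)`. [folklore] -/
theorem support_toWalk (ω : StepSeq d n) :
    (toWalk ω).support = (List.range (n + 1)).map (pos ω) := by
  rw [toWalk, Walk.support_copy, support_walkUpTo ω n le_rfl]

/-- `toWalk ω` has length `n`. [folklore] -/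
theorem length_toWalk (ω : StepSeq d n) : (toWalk ω).length = n := by
  have h := congrArg List.length (support_toWalk ω)
  rw [Walk.length_support, List.length_map, List.length_range] at h
  omega

/-- The `k`-th vertex of `toWalk ω` is `ω(k)`. [folklore] -/
theorem getVert_toWalk (ω : StepSeq d n) {k : ℕ} (hk : k ≤ n) : (toWalk ω).getVert k = pos ω k := by
  rw [Walk.getVert_eq_support_getElem _ (by rw [length_toWalk]; exact hk)]
  simp [support_toWalk]

/-- The step sequence of an `n`-step walk of `zdGraph d` from `0`, read off consecutive vertices.
[folklore] -/
def ofWalk {x : Site d} (p : (zdGraph d).Walk (0 : Site d) x) (hp : p.length = n) : StepSeq d n :=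
  fun i => dirOf (p.adj_getVert_succ (i := i) (by rw [hp]; exact i.isLt))

/-- `ofWalk` recovers the vertices: `pos (ofWalk p) k = p(k)` for `k ≤ |p| = n`. [folklore] -/
theorem pos_ofWalk {x : Site d} (p : (zdGraph d).Walk (0 : Site d) x) (hp : p.length = n) :
    ∀ k, k ≤ n → pos (ofWalk p hp) k = p.getVert k
  | 0, _ => by simp
  | k + 1, hk => by
      have h : k < n := hk
      rw [pos_succ _ h, pos_ofWalk p hp k h.le]
      exact add_stepVec_dirOf _

/-- … in particular the endpoint. [folklore] -/
theorem endpoint_ofWalk {x : Site d} (p : (zdGraph d).Walk (0 : Site d) x) (hp : p.length = n) :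
    endpoint (ofWalk p hp) = x := by
  rw [← pos_eq_endpoint, pos_ofWalk p hp n le_rfl, ← hp, Walk.getVert_length]

/-- `toWalk ∘ ofWalk = id` on `n`-step walks (up to the endpoint cast). [folklore] -/
theorem toWalk_ofWalk {x : Site d} (p : (zdGraph d).Walk (0 : Site d) x) (hp : p.length = n) :
    (toWalk (ofWalk p hp)).copy rfl (endpoint_ofWalk p hp) = p := by
  apply Walk.ext_support
  rw [Walk.support_copy, support_toWalk]
  apply List.ext_getElem
  · simp [Walk.length_support, hp]
  · intro i h1 h2
    have hi : i ≤ n := by simp at h1; omega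
    simp only [List.getElem_map, List.getElem_range]
    rw [pos_ofWalk p hp i hi, Walk.getVert_eq_support_getElem p (by rw [hp]; exact hi)]

/-- `ofWalk ∘ toWalk = id`. [folklore] -/
theorem ofWalk_toWalk (ω : StepSeq d n) : ofWalk (toWalk ω) (length_toWalk ω) = ω := by
  funext i
  unfold ofWalk
  have h1 := getVert_toWalk ω i.isLt.le
  have h2 : (toWalk ω).getVert (i + 1) = pos ω i + stepVec (ω i) := by
    rw [getVert_toWalk ω (Nat.succ_le_of_lt i.isLt), pos_succ ω i.isLt]
  generalize_proofs hadj
  revert hadj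
  rw [h1, h2]
  intro hadj
  exact dirOf_adj_add_stepVec _ _ hadj

/-- Equality in `Σ x, Walk 0 x` from an endpoint identity and a `Walk.copy` identity. [folklore] -/
theorem sigma_eq_of_copy_eq {y : Site d} (q : (zdGraph d).Walk (0 : Site d) y)
    (s : Σ x : Site d, (zdGraph d).Walk (0 : Site d) x) (h : y = s.1) (hq : q.copy rfl h = s.2) :
    (⟨y, q⟩ : Σ x : Site d, (zdGraph d).Walk (0 : Site d) x) = s := by
  obtain ⟨x, p⟩ := s
  dsimp only at h hq
  subst h
  rw [Walk.copy_rfl_rfl] at hq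
  subst hq
  rfl

/-- **Transfer of sums**: summing over the `n`-step walks of `zdGraph d` from `0`, indexed as
`Σ_{x ∈ box d n} Σ_{p ∈ finsetWalkLength n 0 x}` (the indexing of
`Literature.Probability.RandomPlanarGeometry.SAW.Zd.count` and of the jump-chain representation of
the continuous-time walk), is summing over step sequences. [folklore] -/
theorem sum_walks_eq_sum_stepSeq {M : Type*} [AddCommMonoid M]
    (Φ : (x : Site d) → (zdGraph d).Walk (0 : Site d) x → M) :
    ∑ x ∈ box d n, ∑ p ∈ (zdGraph d).finsetWalkLength n (0 : Site d) x, Φ x p =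
      ∑ ω : StepSeq d n, Φ (endpoint ω) (toWalk ω) := by
  rw [← Finset.sum_sigma (box d n) (fun x => (zdGraph d).finsetWalkLength n (0 : Site d) x)
    (fun s => Φ s.1 s.2)]
  symm
  refine Finset.sum_bij' (fun ω _ => (⟨endpoint ω, toWalk ω⟩ : Σ x : Site d, (zdGraph d).Walk 0 x))
    (fun s hs => ofWalk s.2 (mem_finsetWalkLength_iff.1 (Finset.mem_sigma.1 hs).2)) ?_ ?_ ?_ ?_ ?_
  · intro ω _
    exact Finset.mem_sigma.2 ⟨endpoint_mem_box ω, mem_finsetWalkLength_iff.2 (length_toWalk ω)⟩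
  · intro s _
    exact mem_univ _
  · intro ω _
    exact ofWalk_toWalk ω
  · rintro ⟨x, p⟩ hs
    have hp : p.length = n := mem_finsetWalkLength_iff.1 (Finset.mem_sigma.1 hs).2
    exact sigma_eq_of_copy_eq _ _ (endpoint_ofWalk p hp) (toWalk_ofWalk p hp)
  · intro ω _
    rfl

/-! ### Endpoint counts -/

/-- `count d n x = #{ω : StepSeq d n | ω(n) = x}`, the number of `n`-step nearest-neighbour walks
`0 → x` in `ℤ^d` (ALL walks, per endpoint: `= #((zdGraph d).finsetWalkLength n 0 x)` by
`card_finsetWalkLength_eq_count`, `= SAW.Zd.weaklyCountAt d 0 n x` as a real number; not the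
self-avoiding count `SAW.Zd.countAt` of `BDGS2012.lean`); `count d n x / (2d)^n = P(S_n = x)` for
the simple random walk `S`. [folklore] -/
def count (d n : ℕ) (x : Site d) : ℕ :=
  (Finset.univ.filter fun ω : StepSeq d n => endpoint ω = x).card

/-- `count` as a sum of indicators. [folklore] -/
theorem count_eq_sum_ite (d n : ℕ) (x : Site d) :
    count d n x = ∑ ω : StepSeq d n, if endpoint ω = x then 1 else 0 := by
  rw [count, Finset.card_filter]

/-- The number of `n`-step walks `0 → x` of `zdGraph d` is `count d n x` (walks indexed by
`finsetWalkLength`, for `x` in the box that contains all their endpoints). [folklore] -/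
theorem sum_box_card_finsetWalkLength_mul (f : Site d → ℕ) :
    ∑ x ∈ box d n, ((zdGraph d).finsetWalkLength n (0 : Site d) x).card * f x =
      ∑ ω : StepSeq d n, f (endpoint ω) := by
  have h := sum_walks_eq_sum_stepSeq (d := d) (n := n) (M := ℕ) (fun x _ => f x)
  simpa [Finset.sum_const, smul_eq_mul] using h

/-- Walks `0 → x` of length `n` have their endpoint in `box d n`; off the box `count` vanishes.
[folklore] -/
theorem count_eq_zero_of_not_mem_box {x : Site d} (hx : x ∉ box d n) : count d n x = 0 := by
  rw [count, Finset.card_eq_zero, Finset.filter_eq_empty_iff]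
  intro ω _ h
  exact hx (h ▸ endpoint_mem_box ω)

/-- `count d n x = #((zdGraph d).finsetWalkLength n 0 x)`: the step-sequence count is the number
of graph walks. [folklore] -/
theorem card_finsetWalkLength_eq_count (x : Site d) :
    ((zdGraph d).finsetWalkLength n (0 : Site d) x).card = count d n x := by
  classical
  by_cases hx : x ∈ box d n
  · have h := sum_box_card_finsetWalkLength_mul (d := d) (n := n) (fun y => if y = x then 1 else 0)
    rw [Finset.sum_eq_single x] at h
    · simpa [count_eq_sum_ite] using h
    · intro y _ hyx
      simp [hyx]
    · intro h'
      exact absurd hx h'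
  · rw [count_eq_zero_of_not_mem_box hx, Finset.card_eq_zero]
    ext p
    simp only [Finset.notMem_empty, iff_false]
    intro hp
    have hlen : p.length = n := mem_finsetWalkLength_iff.1 hp
    exact hx (endpoint_ofWalk p hlen ▸ endpoint_mem_box _)

/-- Grouping step sequences by endpoint: `Σ_ω f(ω(n)) = Σ_{x ∈ box d n} count d n x · f x`.
[folklore] -/
theorem sum_stepSeq_eq_sum_box_count {M : Type*} [AddCommMonoid M] (f : Site d → M) :
    ∑ ω : StepSeq d n, f (endpoint ω) = ∑ x ∈ box d n, count d n x • f x := by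
  classical
  rw [← sum_walks_eq_sum_stepSeq (fun x _ => f x)]
  refine Finset.sum_congr rfl fun x _ => ?_
  rw [Finset.sum_const, card_finsetWalkLength_eq_count]

/-- Total mass: `Σ_{x ∈ box d n} count d n x = (2d)^n`. [folklore] -/
theorem sum_box_count (d n : ℕ) : ∑ x ∈ box d n, count d n x = (2 * d) ^ n := by
  have h := sum_stepSeq_eq_sum_box_count (d := d) (n := n) (M := ℕ) (fun _ => 1)
  simp only [smul_eq_mul, mul_one, Finset.sum_const, Finset.card_univ, card_stepSeq] at h
  exact h.symm

/-- The empty walk ends at the origin: `count d 0 x = [x = 0]`. [folklore] -/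
theorem count_zero (x : Site d) : count d 0 x = if x = 0 then 1 else 0 := by
  rw [count_eq_sum_ite]
  simp [eq_comm]

/-- Negation symmetry: `count d n (-x) = count d n x`. [folklore] -/
theorem count_neg (x : Site d) : count d n (-x) = count d n x := by
  rw [count_eq_sum_ite, count_eq_sum_ite]
  refine Fintype.sum_bijective (fun ω i => (ω i).neg)
    (Function.Involutive.bijective (fun ω => by funext i; simp)) _ _ fun ω => ?_
  simp only [endpoint_neg, neg_eq_iff_eq_neg]

end SRW

end Literature.Probability.LatticeModels
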